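import Summits.BirchSwinnertonDyer.BirchSwinnertonDyer.Theorems.GenusKolyvaginAtTwoLeafCensusShaCellSplit
import HarnessLib

/-!
# Route `GenusKolyvaginAtTwo` rev 71 — the re-cut BY NAME: Ш-cell `RankOneShaCellBSDTwo` (stmt-27477), torsion residual `RankOneTwoTorsionResidualAtTwo` (stmt-27478) (LEAD bsd-line-gk2-p1 g32)

Seat `bsd-line-gk2-p1` g32 (LEAD lineage, cell `bsd-f1-sign2`).  THEOREMS ONLY, standard axioms, no `sorry`.  **BSD is NOT proved by this file; the leaf
`NonCMAtTwo`, WALL(GK2)×4, U₂ `MinimalTwinBSDTwo` (22985), the Ш-cell `RankOneShaCellBSDTwo` (stmt-BirchSwinnertonDyer-27477, crux r5), the declared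
residual `RankOneTwoTorsionResidualAtTwo` (stmt-BirchSwinnertonDyer-27478), R′ `RankOneNonMinimalResidualAtTwo` (27107, now aside) and KEX⁰|Ш stay OPEN;
nothing is closed.**

After the (726)/(730)/(735) re-cut (planner-of-record bsd-idea-1 g29, revs 68–71, commit bd6d3a7c0836: `closes` = WALL(GK2)×4 + U₂ + Ш-cell + R″, all
BY NAME, every binder used) this file restates the census of p801119 `…Census.ShaCell` (which had to spell the Ш-cell and the torsion cell out) against
the NEW DECL NAMES:
* §1 `Iff.rfl` ×2 (+ `rfl` on the Prop equalities, REF1 rider R409b): the new decls ARE p801119's spelled-out binders, definitionally;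
* §2 ★ `rankOneNonMinimalResidualAtTwo_iff_shaCell_and_torsionResidual`: **R′ (27107) ⟺ `RankOneShaCellBSDTwo` ∧ `RankOneTwoTorsionResidualAtTwo`** (→ mod GZK)
  — the re-cut moved exactly the Ш-cell out of the residual; ★ `nonCMAtTwo_iff_closesBinders`: **NonCMAtTwo ⟺ the seven `closes` binders** (lossless,
  pure logic — the kernel form of «binder_used = all seven, none idle»); «rank-one BSD₂» ⟺ U₂ ∧ Ш-cell ∧ R″;
* §3 ★ `rankOneShaCellBSDTwo_of_wall_of_friedbergHoffstein_of_kex0Sha_of_facts`: **the new crux BY NAME ⟸ WALL row 1 + Friedberg–Hoffstein + KEX⁰|Ш +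
  PRINT** (conditional closer; KEX⁰|Ш = LINE 23's index relation on the frames with `W(ℚ)[2] = 0`, `#Sel₂(W) ≠ 2`), and its lossless converse.

References: [SilvermanAEC2009] Thm X.4.2; [Miller2011LMS] Def. 1.1; [GrossZagier1986] V.§2 (2.2); [FriedbergHoffstein1995]; [Milne1972ArithmeticAV] §1 Thm. 1.
-/

set_option autoImplicit false
set_option linter.dupNamespace false -- `Summit.<P>.<Sub>` repeats `BirchSwinnertonDyer` (D-0017)

noncomputable section

open scoped Classical NumberField

namespace Summit.BirchSwinnertonDyer.BirchSwinnertonDyer.Theorems.GenusExact.Census.ShaCell.ByName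

open WeierstrassCurve NumberField Literature.NumberTheory.EllipticCurves
  Literature.NumberTheory.EllipticCurves.ModularForms
  Summit.BirchSwinnertonDyer.BirchSwinnertonDyer.Rank1Residual
  Summit.BirchSwinnertonDyer.BirchSwinnertonDyer.Theorems.GenusExact.TwinSwap
  Summit.BirchSwinnertonDyer.BirchSwinnertonDyer.Theorems.GenusExact.TwinSwap.AnalyticTwin
  Summit.BirchSwinnertonDyer.BirchSwinnertonDyer.Theorems.GenusExact.TwinSwap.AnalyticTwin.NoTwoTorsion
  Summit.BirchSwinnertonDyer.BirchSwinnertonDyer.Theorems.GenusExact.Census.ShaCell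
open Summit.BirchSwinnertonDyer.BirchSwinnertonDyer.Theorems.GenusExact.Census.TorsionCell (bsdp_rankZero_of_wallGK2)
open Summit.BirchSwinnertonDyer.BirchSwinnertonDyer.Theses.GenusKolyvaginAtTwo
  (WallGoodOrdinaryRankZeroAtTwo WallMultiplicativeRankZeroAtTwo WallSupersingularRankZeroAtTwo WallAdditiveRankZeroAtTwo
   MinimalTwinBSDTwo RankOneNonMinimalResidualAtTwo RankOneShaCellBSDTwo RankOneTwoTorsionResidualAtTwo)

/-! ## §1 The new decls are the spelled-out cells verbatim -/

/-- `RankOneShaCellBSDTwo` (rev 69/71, stmt-27477) IS the Ш-cell of p801119, verbatim. [folklore] -/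
theorem rankOneShaCellBSDTwo_iff :
    RankOneShaCellBSDTwo ↔
      ∀ (W : WeierstrassCurve ℚ) [W.IsElliptic] [W.IsGloballyMinimal],
        ¬ W.HasCM → W.analyticRank = 1 → (∀ P : W.toAffine.Point, 2 • P = 0 → P = 0) → Nat.card (W.selmerGroup 2) ≠ 2 → BSDp W 2 :=
  Iff.rfl

/-- REF1 rider R409b: the same as a definitional EQUALITY of propositions (`rfl`). [folklore] -/
theorem rankOneShaCellBSDTwo_eq :
    RankOneShaCellBSDTwo =
      ∀ (W : WeierstrassCurve ℚ) [W.IsElliptic] [W.IsGloballyMinimal],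
        ¬ W.HasCM → W.analyticRank = 1 → (∀ P : W.toAffine.Point, 2 • P = 0 → P = 0) → Nat.card (W.selmerGroup 2) ≠ 2 → BSDp W 2 :=
  rfl

/-- `RankOneTwoTorsionResidualAtTwo` (rev 69/71, stmt-27478, the declared residual) IS the torsion cell of p798939/p801119, verbatim. [folklore] -/
theorem rankOneTwoTorsionResidualAtTwo_iff :
    RankOneTwoTorsionResidualAtTwo ↔
      ∀ (W : WeierstrassCurve ℚ) [W.IsElliptic] [W.IsGloballyMinimal],
        ¬ W.HasCM → W.analyticRank = 1 → (¬ ∀ P : W.toAffine.Point, 2 • P = 0 → P = 0) → BSDp W 2 :=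
  Iff.rfl

/-- REF1 rider R409b: the same as a definitional EQUALITY of propositions (`rfl`). [folklore] -/
theorem rankOneTwoTorsionResidualAtTwo_eq :
    RankOneTwoTorsionResidualAtTwo =
      ∀ (W : WeierstrassCurve ℚ) [W.IsElliptic] [W.IsGloballyMinimal],
        ¬ W.HasCM → W.analyticRank = 1 → (¬ ∀ P : W.toAffine.Point, 2 • P = 0 → P = 0) → BSDp W 2 :=
  rfl

/-! ## §2 The re-cut is lossless BY NAME -/

/-- ★ **R′ `RankOneNonMinimalResidualAtTwo` (27107, now aside) ⟺ `RankOneShaCellBSDTwo` ∧ `RankOneTwoTorsionResidualAtTwo`** — the rev-67 residual is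
EXACTLY the new crux plus the new residual (← pure logic; → modulo GZK = item `MultPublishedInputsAtTwo`).  So the re-cut moved the Ш-cell from the
residual to the attacked side and nothing else.  CONDITIONAL; closes nothing. [cite: SilvermanAEC2009, Thm X.4.2] -/
theorem rankOneNonMinimalResidualAtTwo_iff_shaCell_and_torsionResidual (hGZK : rank_eq_analyticRank_of_analyticRank_le_one) :
    RankOneNonMinimalResidualAtTwo ↔ RankOneShaCellBSDTwo ∧ RankOneTwoTorsionResidualAtTwo :=
  rankOneNonMinimalResidualAtTwo_iff_shaCell_and_torsionCell hGZK

/-- **R″ ⟸ R′** and **Ш-cell ⟸ R′** BY NAME (the two new statements are sub-statements of the old residual; the first modulo GZK). [cite: SilvermanAEC2009, Thm X.4.2] -/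
theorem shaCell_and_torsionResidual_of_rankOneNonMinimalResidualAtTwo (hGZK : rank_eq_analyticRank_of_analyticRank_le_one)
    (hR : RankOneNonMinimalResidualAtTwo) : RankOneShaCellBSDTwo ∧ RankOneTwoTorsionResidualAtTwo :=
  (rankOneNonMinimalResidualAtTwo_iff_shaCell_and_torsionResidual hGZK).mp hR

/-- **R′ ⟸ Ш-cell ∧ R″** BY NAME, pure logic. [folklore] -/
theorem rankOneNonMinimalResidualAtTwo_of_shaCell_of_torsionResidual (hSha : RankOneShaCellBSDTwo) (hT : RankOneTwoTorsionResidualAtTwo) :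
    RankOneNonMinimalResidualAtTwo :=
  rankOneNonMinimalResidualAtTwo_of_shaCell_of_torsionCell hSha hT

/-- **«BSD₂ for every non-CM `W` of analytic rank one» ⟺ U₂ ∧ Ш-cell ∧ R″**, all three BY NAME — the three-cell partition of the rank-one half of the
leaf (pure logic). [folklore] -/
theorem rankOneBSDTwo_iff_minimalTwin_and_shaCell_and_torsionResidual :
    (∀ (W : WeierstrassCurve ℚ) [W.IsElliptic] [W.IsGloballyMinimal], ¬ W.HasCM → W.analyticRank = 1 → BSDp W 2) ↔
      MinimalTwinBSDTwo ∧ RankOneShaCellBSDTwo ∧ RankOneTwoTorsionResidualAtTwo :=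
  rankOneBSDTwo_iff_minimalTwinBSDTwo_and_shaCell_and_torsionCell

/-- ★ **NonCMAtTwo ⟺ the seven `closes` binders of rev 71** (WALL(GK2)×4 ∧ U₂ ∧ Ш-cell ∧ R″, all BY NAME) — LOSSLESS, pure logic: the kernel form of
«every binder load-bearing, none idle, and together they are exactly the leaf».  Census only; BSD is NOT proved. [cite: Miller2011LMS, Def. 1.1] -/
theorem nonCMAtTwo_iff_closesBinders :
    NonCMAtTwo ↔
      (WallGoodOrdinaryRankZeroAtTwo ∧ WallMultiplicativeRankZeroAtTwo ∧ WallSupersingularRankZeroAtTwo ∧ WallAdditiveRankZeroAtTwo) ∧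
      MinimalTwinBSDTwo ∧ RankOneShaCellBSDTwo ∧ RankOneTwoTorsionResidualAtTwo :=
  nonCMAtTwo_iff_wallGK2_and_minimalTwinBSDTwo_and_shaCell_and_torsionCell

/-- **The `closes`-shaped term BY NAME** (= the rev-71 deciding theorem `closes`, restated from the Theorems side): WALL(GK2)×4 + U₂ + Ш-cell + R″ ⟹ NonCMAtTwo.
CONDITIONAL (all seven are hypotheses = open route items); proves nothing about BSD; closes nothing. [cite: Miller2011LMS, Def. 1.1] -/
theorem nonCMAtTwo_of_closesBinders (hOrd : WallGoodOrdinaryRankZeroAtTwo) (hMult : WallMultiplicativeRankZeroAtTwo)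
    (hSS : WallSupersingularRankZeroAtTwo) (hAdd : WallAdditiveRankZeroAtTwo) (hTw : MinimalTwinBSDTwo) (hSha : RankOneShaCellBSDTwo)
    (hT : RankOneTwoTorsionResidualAtTwo) : NonCMAtTwo :=
  nonCMAtTwo_of_wallGK2_of_minimalTwinBSDTwo_of_shaCell_of_torsionCell hOrd hMult hSS hAdd hTw hSha hT

/-- **The Ш-cell in Ш-currency, BY NAME** (mod GZK): `RankOneShaCellBSDTwo` ⟺ «non-CM, `r_an = 1`, `W(ℚ)[2] = 0`, `#(Ш(W) ⊓ H¹(ℚ,W)[2]) ≠ 1` ⟹ BSD₂».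
[cite: SilvermanAEC2009, Thm X.4.2] -/
theorem rankOneShaCellBSDTwo_iff_shaCellSha (hGZK : rank_eq_analyticRank_of_analyticRank_le_one) :
    RankOneShaCellBSDTwo ↔
      (∀ (W : WeierstrassCurve ℚ) [W.IsElliptic] [W.IsGloballyMinimal],
        ¬ W.HasCM → W.analyticRank = 1 → (∀ P : W.toAffine.Point, 2 • P = 0 → P = 0) →
          Nat.card (W.sha ⊓ AddSubgroup.torsionBy W.galH1 2 : AddSubgroup W.galH1) ≠ 1 → BSDp W 2) :=
  shaCell_iff_shaCellSha hGZK

/-! ## §3 The new crux BY NAME from its road: WALL row 1 + Friedberg–Hoffstein + KEX⁰|Ш + PRINT (conditional), lossless -/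

/-- ★ **`RankOneShaCellBSDTwo` BY NAME ⟸ WALL(GK2)×4 + Friedberg–Hoffstein + KEX⁰|Ш + PRINT** — p801119's `shaCell_of_wall_of_friedbergHoffstein_of_kex0Sha_of_facts`
with its S1′ input discharged from the four WALL binders (p798939 `bsdp_rankZero_of_wallGK2`).  KEX⁰|Ш (`hKEX0Sha`) = the `2`-primary Gross–Zagier index
relation at SOME exact `2`-depth of `P(1)`, at every odd Heegner frame with `2` split and any globally minimal twin, for the curves of the cell — the one
research statement; everything else is PRINT or WALL.  CONDITIONAL on the displayed hypotheses; proves nothing about BSD; closes nothing.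
[cite: FriedbergHoffstein1995, main theorem] [cite: GrossZagier1986, V.§2 (2.2)] [cite: Milne1972ArithmeticAV, §1 Thm. 1] [cite: BCDTJAMS2001, Thm. A] -/
theorem rankOneShaCellBSDTwo_of_wall_of_friedbergHoffstein_of_kex0Sha_of_facts
    (hGZ : ∀ (N : ℕ) [NeZero N] (W : WeierstrassCurve ℚ) (K : Type) [Field K] [NumberField K], gross_zagier N W K)
    (hGZK : rank_eq_analyticRank_of_analyticRank_le_one) (hmod : hasEntireLFunction_rat)
    (hMilneC : Milne1972.bsdQuotient_baseChange_quadratic_anyModel) (hMP : nonempty_modularParametrizationData)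
    (hFH : friedbergHoffstein_exists_heegnerField_split_twist_ne_zero)
    (hOrd : WallGoodOrdinaryRankZeroAtTwo) (hMult : WallMultiplicativeRankZeroAtTwo)
    (hSS : WallSupersingularRankZeroAtTwo) (hAdd : WallAdditiveRankZeroAtTwo)
    (hKEX0Sha : ∀ (W : WeierstrassCurve ℚ) [W.IsElliptic] [W.IsGloballyMinimal] [NeZero (W.conductorNorm ℤ)],
      ¬ W.HasCM → W.analyticRank = 1 → (∀ P : W.toAffine.Point, 2 • P = 0 → P = 0) → Nat.card (W.selmerGroup 2) ≠ 2 →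
      ∀ (K : Type) [Field K] [NumberField K], IsImaginaryQuadratic K →
        Odd (NumberField.discr K) → NumberField.discr K ≠ -3 → SatisfiesHeegnerHypothesis (W.conductorNorm ℤ) K →
        ((Ideal.span {(2 : ℤ)}).primesOver (𝓞 K)).ncard = 2 →
        ∀ (Wd : WeierstrassCurve ℚ) [Wd.IsElliptic] [Wd.IsGloballyMinimal],
          (∃ C : VariableChange ℚ, C • W.quadraticTwist (NumberField.discr K : ℚ) = Wd) →
        (W.quadraticTwist (NumberField.discr K : ℚ)).entireLFunction 1 ≠ 0 →
        ∀ (Dt : ModularParametrizationData W (W.conductorNorm ℤ)) (β : ℤ) (ι : K →+* ℂ) (d₁ : KolyvaginHeegnerData Dt β ι 1),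
          ∃ M₀ : ℕ,
            (∃ Q : (W.baseChange (ringClassField K ι 1)).toAffine.Point, ((2 ^ M₀ : ℕ) : ℤ) • Q = d₁.derivedPoint) ∧
            (¬ ∃ Q : (W.baseChange (ringClassField K ι 1)).toAffine.Point, ((2 ^ (M₀ + 1) : ℕ) : ℤ) • Q = d₁.derivedPoint) ∧
            Nat.card (AddCommGroup.primaryComponent (W.baseChange K).sha 2) *
                2 ^ (2 * (padicValInt 2 Dt.c + padicValNat 2 W.tamagawaProduct)) = 2 ^ (2 * M₀)) :
    RankOneShaCellBSDTwo :=
  shaCell_of_wall_of_friedbergHoffstein_of_kex0Sha_of_facts hGZ hGZK hmod hMilneC hMP hFH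
    (fun W _ _ hcm hr0 ↦ bsdp_rankZero_of_wallGK2 hOrd hMult hSS hAdd W hcm hr0) hKEX0Sha

/-- ★ **KEX⁰|Ш ⟸ `RankOneShaCellBSDTwo` + WALL(GK2)×4 + PRINT** (lossless converse, BY NAME; Friedberg–Hoffstein not needed): modulo WALL + PRINT the new
crux is EQUIVALENT to its one research statement KEX⁰|Ш.  CONDITIONAL; closes nothing. [cite: GrossZagier1986, V.§2 (2.2)] [cite: Milne1972ArithmeticAV, §1 Thm. 1] -/
theorem kex0Sha_of_rankOneShaCellBSDTwo_of_wall_of_facts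
    (hGZ : ∀ (N : ℕ) [NeZero N] (W : WeierstrassCurve ℚ) (K : Type) [Field K] [NumberField K], gross_zagier N W K)
    (hGZK : rank_eq_analyticRank_of_analyticRank_le_one) (hmod : hasEntireLFunction_rat)
    (hMilneC : Milne1972.bsdQuotient_baseChange_quadratic_anyModel)
    (hOrd : WallGoodOrdinaryRankZeroAtTwo) (hMult : WallMultiplicativeRankZeroAtTwo)
    (hSS : WallSupersingularRankZeroAtTwo) (hAdd : WallAdditiveRankZeroAtTwo) (hSha : RankOneShaCellBSDTwo) :
    ∀ (W : WeierstrassCurve ℚ) [W.IsElliptic] [W.IsGloballyMinimal] [NeZero (W.conductorNorm ℤ)],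
      ¬ W.HasCM → W.analyticRank = 1 → (∀ P : W.toAffine.Point, 2 • P = 0 → P = 0) → Nat.card (W.selmerGroup 2) ≠ 2 →
      ∀ (K : Type) [Field K] [NumberField K], IsImaginaryQuadratic K →
        Odd (NumberField.discr K) → NumberField.discr K ≠ -3 → SatisfiesHeegnerHypothesis (W.conductorNorm ℤ) K →
        ((Ideal.span {(2 : ℤ)}).primesOver (𝓞 K)).ncard = 2 →
        ∀ (Wd : WeierstrassCurve ℚ) [Wd.IsElliptic] [Wd.IsGloballyMinimal],
          (∃ C : VariableChange ℚ, C • W.quadraticTwist (NumberField.discr K : ℚ) = Wd) →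
        (W.quadraticTwist (NumberField.discr K : ℚ)).entireLFunction 1 ≠ 0 →
        ∀ (Dt : ModularParametrizationData W (W.conductorNorm ℤ)) (β : ℤ) (ι : K →+* ℂ) (d₁ : KolyvaginHeegnerData Dt β ι 1),
          ∃ M₀ : ℕ,
            (∃ Q : (W.baseChange (ringClassField K ι 1)).toAffine.Point, ((2 ^ M₀ : ℕ) : ℤ) • Q = d₁.derivedPoint) ∧
            (¬ ∃ Q : (W.baseChange (ringClassField K ι 1)).toAffine.Point, ((2 ^ (M₀ + 1) : ℕ) : ℤ) • Q = d₁.derivedPoint) ∧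
            Nat.card (AddCommGroup.primaryComponent (W.baseChange K).sha 2) *
                2 ^ (2 * (padicValInt 2 Dt.c + padicValNat 2 W.tamagawaProduct)) = 2 ^ (2 * M₀) :=
  kex0Sha_of_shaCell_of_wall_of_facts hGZ hGZK hmod hMilneC (fun W _ _ hcm hr0 ↦ bsdp_rankZero_of_wallGK2 hOrd hMult hSS hAdd W hcm hr0) hSha

end Summit.BirchSwinnertonDyer.BirchSwinnertonDyer.Theorems.GenusExact.Census.ShaCell.ByName

end
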